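import Literature.RingTheory.KTheory.MilnorKStiefelWhitneyBinary
import Literature.RingTheory.KTheory.MilnorKStar
import HarnessLib

/-!
# The ring `k_*F = K_*F/2K_*F` and the Stiefel–Whitney invariant `w(M) = ∏ (1 + l(aᵢ))` of a diagonalized quadratic
# module: Whitney sum formula and LEMMA 3.1 modulo chain equivalence (Milnor, *Algebraic K-theory and quadratic
# forms*, Invent. Math. 9 (1970), §3)

Family `hodge`, lane `lit-hodgefound` (foundations library; seat `lit-hodgefound-p27`, generation 40, row g40-#14);
topic `RingTheory/KTheory`.  Sequel of `MilnorKStar` (g40-#7: Milnor's ring `K_*F = MilnorKStar F`, `l`, `ofDeg`,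
LEMMA 1.1/1.2 `l_mul_l_add`, `l_mul_self`, `mk_ι_eq_word`), `MilnorKModTwo` (g40-#9: `k_nF = MilnorK.Mod2 F n`, `kmk`,
`kSymbol`) and `MilnorKStiefelWhitneyBinary` (g40-#10: the binary module `binaryForm a b = (a) ⊕ (b)`, `swOne`, `swTwo`,
`sw_eq_of_isometryEquiv`).  DEFINITIONS WITH BODIES (`twoRel`, the `abbrev Mod2Ring`, `toMod2`, `kl`, `kOfDeg`, `sw`,
the `inductive ChainStep`, `ChainEquiv`, `binaryFormSwap`) and PROVED THEOREMS; no named fact, no instance (the ring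
structure of `k_*F` is Mathlib's `RingQuot` structure, reached through the `abbrev`), no notation, 0 `sorry`, net
debt 0 (D-0026).

## The source, verbatim

J. Milnor, *Algebraic K-theory and quadratic forms*, Invent. Math. 9 (1970) 318–344 (held `paper:doi-10-1007-bf01425486`;
bib key `Milnor1970`), §3 (p0010 L27 – p0011 L12): «For the rest of this paper we will only be interested in the
quotient of the ring K_*F by the ideal 2K_*F. To simplify the notation, let us set k_nF = K_nF/2K_nF. Thus k_*F is a
graded algebra over Z/2Z […] The symbol k_ΠF will stand for the algebra consisting of all formal series
x₀ + x₁ + x₂ + ⋯ with xᵢ ∈ kᵢF. […] Let M be a quadratic module over F. […] Then M is isomorphic to an orthogonal direct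
sum (a₁) ⊕ ⋯ ⊕ (a_r) of one dimensional modules. […] Define the Stiefel-Whitney invariant w(M) ∈ k_ΠF of a quadratic
module M ≅ (a₁) ⊕ ⋯ ⊕ (a_r) by the formula w(M) = (1 + l(a₁))(1 + l(a₂))⋯(1 + l(a_r)). Thus w(M) can be written as
1 + w₁(M) + ⋯ + w_r(M)»; and (p0011 L24–L29): «LEMMA 3.1. The invariant w(M) is a well defined unit in the ring
k_ΠF and satisfies the Whitney sum formula w(M ⊕ N) = w(M)w(N). *Proof.* Just as in the classical proof that the
Hasse-Witt invariant is well defined, it suffices to consider the rank 2 case. (Compare O'Meara [12, p. 150].)»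

## What is formalised

* §1 **the ring `k_*F`**: `Mod2Ring F := RingQuot (2 ∼ 0)` over `K_*F` (an `abbrev`), the projection `toMod2`,
  `two_eq_zero`, `add_self : x + x = 0`; the generators `kl a = l(a) mod 2` with `kl_mul`, `kl_inv`, `kl_sq`,
  `kl_mul_sq` (squares die), the Steinberg relation, LEMMA 1.1 mod `2` `kl_mul_comm` and **`mul_comm'`: `k_*F` is
  commutative**, LEMMA 1.2 mod `2` `kl_mul_self`; the canonical maps **`kOfDeg F n : k_nF →+ k_*F`** from the graded
  pieces of `MilnorKModTwo` (`kOfDeg_kSymbol : {a₁, …, aₙ} ↦ l(a₁)⋯l(aₙ)`).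
* §2 **the Stiefel–Whitney invariant of a diagonalization** `d = [a₁, …, a_r]` (the module `(a₁) ⊕ ⋯ ⊕ (a_r)`):
  **`sw F d = (1 + l(a₁))⋯(1 + l(a_r))`**, as printed but in the ring `k_*F` itself (a finite product; the formal-series
  ring `k_ΠF` is only needed to make `w(M)` a unit and is not used here); **the Whitney sum formula `sw_append`**;
  `sw_pair_eq : w((a) ⊕ (b)) = 1 + w₁ + w₂` with the `w₁ ∈ k₁F`, `w₂ ∈ k₂F` of `MilnorKStiefelWhitneyBinary`; and the
  rank-`2` case **`sw_pair_eq_of_equivalent : (a) ⊕ (b) ≅ (α) ⊕ (β) ⇒ w = w'`** (characteristic `≠ 2`).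
* §3 **LEMMA 3.1 modulo Witt's chain-equivalence theorem**: `ChainStep`/`ChainEquiv` — two diagonalizations are chain
  equivalent when they are joined by steps replacing two adjacent entries `a, b` by `α, β` with `(a) ⊕ (b) ≅ (α) ⊕ (β)`
  (adjacent transpositions are such steps, `chainStep_swap`) — and **`sw_eq_of_chainEquiv`**: chain-equivalent
  diagonalizations have the same Stiefel–Whitney invariant («it suffices to consider the rank 2 case»).

Not here: Witt's chain-equivalence theorem itself (isometric diagonalizations are chain equivalent — «the classical
proof that the Hasse-Witt invariant is well defined», O'Meara p. 150), hence `w(M)` as a function of the isometry class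
of an abstract quadratic module; the ring `k_ΠF` of formal series and the unit property.

## References

* [Milnor1970] J. Milnor, *Algebraic K-theory and quadratic forms*, Invent. Math. 9 (1970) 318–344 — §3, `k_*F` and
  the Stiefel–Whitney invariant (p0010 L27 – p0011 L12), Lemma 3.1 (p0011 L24 – p0012 L6).

Provenance: lane `lit-hodgefound`, seat `lit-hodgefound-p27` gen 40 (agent `literature-prover-lit-hodgefound-p27-g40-0`),
row g40-#14.
-/

set_option autoImplicit false

noncomputable section

namespace Literature.RingTheory.KTheory

open Function

section Field

variable (F : Type*) [Field F]

namespace MilnorKStar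

/-- The relation `2 ∼ 0` on `K_*F` (generating the two-sided ideal `2K_*F`). [cite: Milnor1970, §3, the ring k_*F (p0010 L27–L31)] -/
def twoRel (x y : MilnorKStar F) : Prop := x = 2 ∧ y = 0

/-- **The ring `k_*F = K_*F / 2K_*F`** («the quotient of the ring K_*F by the ideal 2K_*F»), Mathlib's `RingQuot` of `K_*F` by
`2 ∼ 0` (an `abbrev`; no instance is declared). [cite: Milnor1970, §3 «the quotient of the ring K_*F by the ideal 2K_*F […] k_*F is a graded algebra over Z/2Z» (p0010 L27–L31)] -/
abbrev Mod2Ring : Type _ := RingQuot (twoRel F)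

/-- The projection `K_*F → k_*F`. [cite: Milnor1970, §3, the ring k_*F (p0010 L27–L31)] -/
def toMod2 : MilnorKStar F →ₐ[ℤ] Mod2Ring F := RingQuot.mkAlgHom ℤ (twoRel F)

/-- `K_*F → k_*F` is onto. [cite: Milnor1970, §3, the ring k_*F (p0010 L27–L31)] -/
theorem toMod2_surjective : Function.Surjective (toMod2 F) := RingQuot.mkAlgHom_surjective ℤ (twoRel F)

/-- `2 = 0` in `k_*F`. [cite: Milnor1970, §3 «the quotient of the ring K_*F by the ideal 2K_*F […] k_*F is a graded algebra over Z/2Z» (p0010 L27–L31)] -/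
theorem two_eq_zero : (2 : Mod2Ring F) = 0 := by
  have h : twoRel F 2 0 := ⟨rfl, rfl⟩
  have := RingQuot.mkAlgHom_rel ℤ h
  rwa [map_ofNat, map_zero] at this

/-- **`k_*F` is an algebra over `ℤ/2ℤ`**: `x + x = 0`. [cite: Milnor1970, §3 «the quotient of the ring K_*F by the ideal 2K_*F […] k_*F is a graded algebra over Z/2Z» (p0010 L27–L31)] -/
theorem add_self (x : Mod2Ring F) : x + x = 0 := by rw [← two_mul, two_eq_zero, zero_mul]

/-- The generator `l(a) ∈ k_*F` (the class of `l(a) ∈ K_*F`). [cite: Milnor1970, §3, the ring k_*F (p0010 L27–L31)] -/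
def kl (a : Fˣ) : Mod2Ring F := toMod2 F (l F a)

/-- `kl` unfolded. [cite: Milnor1970, §3, the ring k_*F (p0010 L27–L31)] -/
theorem kl_def (a : Fˣ) : kl F a = toMod2 F (l F a) := rfl

/-- `l(ab) = l(a) + l(b)` in `k_*F`. [cite: Milnor1970, §3, the ring k_*F (p0010 L27–L31)] -/
theorem kl_mul (a b : Fˣ) : kl F (a * b) = kl F a + kl F b := by rw [kl, l_mul, map_add]; rfl

/-- `l(1) = 0` in `k_*F`. [cite: Milnor1970, §3, the ring k_*F (p0010 L27–L31)] -/
theorem kl_one : kl F 1 = 0 := by rw [kl, l_one, map_zero]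

/-- `l(a⁻¹) = l(a)` in `k_*F`. [cite: Milnor1970, §3, the ring k_*F (p0010 L27–L31)] -/
theorem kl_inv (a : Fˣ) : kl F a⁻¹ = kl F a := by
  have h : kl F a⁻¹ + kl F a = 0 := by rw [← kl_mul, inv_mul_cancel, kl_one]
  exact (eq_neg_of_add_eq_zero_left h).trans (eq_neg_of_add_eq_zero_left (add_self F (kl F a))).symm

/-- `l(a²) = 0` in `k_*F` («k₁F ≅ F•/F•²»). [cite: Milnor1970, §3 (p0010 L31)] -/
theorem kl_sq (a : Fˣ) : kl F (a ^ 2) = 0 := by rw [pow_two, kl_mul, add_self]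

/-- `l(ab²) = l(a)` in `k_*F`: squares die. [cite: Milnor1970, §3 (p0010 L31)] -/
theorem kl_mul_sq (a b : Fˣ) : kl F (a * b ^ 2) = kl F a := by rw [kl_mul, kl_sq, add_zero]

/-- The Steinberg relation `l(a)l(1 − a) = 0` in `k_*F`. [cite: Milnor1970, §3, the ring k_*F (p0010 L27–L31)] -/
theorem kl_mul_kl_eq_zero {a b : Fˣ} (h : (a : F) + b = 1) : kl F a * kl F b = 0 := by
  rw [kl, kl, ← map_mul, l_mul_l_eq_zero F h, map_zero]

/-- **LEMMA 1.1 mod `2`: `l(a)l(b) = l(b)l(a)` in `k_*F`** (`l(a)l(b) + l(b)l(a) = 0` in `K_*F` and `−x = x`). [cite: Milnor1970, §1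
Lemma 1.1 (p0002 L33–L35); §3 (p0010 L30–L31)] -/
theorem kl_mul_comm (a b : Fˣ) : kl F a * kl F b = kl F b * kl F a := by
  have h : kl F a * kl F b + kl F b * kl F a = 0 := by
    rw [kl, kl, ← map_mul, ← map_mul, ← map_add, l_mul_l_add, map_zero]
  exact (eq_neg_of_add_eq_zero_left h).trans (eq_neg_of_add_eq_zero_left (add_self F _)).symm

/-- LEMMA 1.2 in `k_*F`: `l(a)² = l(a)l(−1)`. [cite: Milnor1970, §1 Lemma 1.2 (p0002 L48–L50)] -/
theorem kl_mul_self (a : Fˣ) : kl F a * kl F a = kl F a * kl F (-1) := by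
  rw [kl, kl, ← map_mul, ← map_mul, l_mul_self]; rfl

/-- `l(a)` is central in `k_*F`. [cite: Milnor1970, §1 Lemma 1.1 (p0002 L33–L35); §3 (p0010 L30–L31)] -/
theorem kl_comm (a : Fˣ) (y : Mod2Ring F) : kl F a * y = y * kl F a := by
  obtain ⟨y, rfl⟩ := toMod2_surjective F y
  obtain ⟨t, rfl⟩ := RingQuot.mkAlgHom_surjective ℤ (MilnorKStar.rel F) y
  induction t using TensorAlgebra.induction with
  | algebraMap r => rw [AlgHom.commutes, AlgHom.commutes]; exact (Algebra.commutes r (kl F a)).symm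
  | ι x => rw [mk_ι_eq_word, word_singleton]; exact kl_mul_comm F a (Additive.toMul x)
  | mul t₁ t₂ h₁ h₂ => rw [map_mul, map_mul, ← _root_.mul_assoc, h₁, _root_.mul_assoc, h₂, _root_.mul_assoc]
  | add t₁ t₂ h₁ h₂ => rw [map_add, map_add, mul_add, add_mul, h₁, h₂]

/-- **The ring `k_*F` is commutative** (generated by the pairwise commuting `l(a)`). [cite: Milnor1970, §1 Lemma 1.1 (p0002
L33–L35); §3 «k_*F is a graded algebra over Z/2Z» (p0010 L30–L31)] -/
theorem mul_comm' (x y : Mod2Ring F) : x * y = y * x := by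
  obtain ⟨x, rfl⟩ := toMod2_surjective F x
  obtain ⟨t, rfl⟩ := RingQuot.mkAlgHom_surjective ℤ (MilnorKStar.rel F) x
  induction t using TensorAlgebra.induction with
  | algebraMap r => rw [AlgHom.commutes, AlgHom.commutes]; exact Algebra.commutes r y
  | ι x => rw [mk_ι_eq_word, word_singleton]; exact kl_comm F (Additive.toMul x) y
  | mul t₁ t₂ h₁ h₂ => rw [map_mul, map_mul, _root_.mul_assoc, h₂, ← _root_.mul_assoc, h₁, _root_.mul_assoc]
  | add t₁ t₂ h₁ h₂ => rw [map_add, map_add, mul_add, add_mul, h₁, h₂]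

/-! ### the graded pieces `k_nF → k_*F` -/

/-- **The canonical maps `k_nF → k_*F`** from the graded pieces `k_nF = K_nF/2K_nF` of `MilnorKModTwo`, induced by
`ofDeg : K_nF → K_*F` (which carries `2K_nF` into `2K_*F`). [cite: Milnor1970, §3 «the quotient of the ring K_*F by the ideal 2K_*F […] k_*F is a graded algebra over Z/2Z» (p0010 L27–L31)] -/
def kOfDeg (n : ℕ) : MilnorK.Mod2 F n →+ Mod2Ring F :=
  QuotientAddGroup.lift (MilnorK.twoMultiples F n) ((toMod2 F).toRingHom.toAddMonoidHom.comp (ofDeg F n)) (by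
    rintro x ⟨z, rfl⟩
    rw [AddMonoidHom.mem_ker, zsmulAddGroupHom_apply]
    change toMod2 F (ofDeg F n ((2 : ℤ) • z)) = 0
    rw [map_zsmul, map_zsmul, two_zsmul, add_self])

/-- `kOfDeg` on classes. [cite: Milnor1970, §3, the ring k_*F (p0010 L27–L31)] -/
theorem kOfDeg_kmk {n : ℕ} (x : MilnorK F n) : kOfDeg F n (MilnorK.kmk F n x) = toMod2 F (ofDeg F n x) :=
  QuotientAddGroup.lift_mk _ _ x

/-- `kOfDeg {a₁, …, aₙ} = l(a₁)⋯l(aₙ)`. [cite: Milnor1970, §3, the ring k_*F (p0010 L27–L31)] -/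
theorem kOfDeg_kSymbol {n : ℕ} (a : Fin n → Fˣ) :
    kOfDeg F n (MilnorK.kSymbol a) = (List.ofFn fun j => kl F (a j)).prod := by
  rw [MilnorK.kSymbol_def, kOfDeg_kmk, ofDeg_symbol, map_list_prod, List.map_ofFn]
  rfl

/-- `w₁((a) ⊕ (b)) ↦ l(a) + l(b)` in `k_*F`. [cite: Milnor1970, §3 «w(M) = (1 + l(a₁))(1 + l(a₂))⋯(1 + l(a_r))» (p0011 L1–L6)] -/
theorem kOfDeg_swOne (a b : Fˣ) : kOfDeg F 1 (MilnorK.swOne a b) = kl F a + kl F b := by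
  rw [MilnorK.swOne_def, map_add, kOfDeg_kSymbol, kOfDeg_kSymbol]
  simp

/-- `w₂((a) ⊕ (b)) ↦ l(a)l(b)` in `k_*F`. [cite: Milnor1970, §3 «w(M) = (1 + l(a₁))(1 + l(a₂))⋯(1 + l(a_r))» (p0011 L1–L6)] -/
theorem kOfDeg_swTwo (a b : Fˣ) : kOfDeg F 2 (MilnorK.swTwo a b) = kl F a * kl F b := by
  rw [MilnorK.swTwo_def, MilnorK.kpair_def, kOfDeg_kSymbol]
  simp

/-! ### the Stiefel–Whitney invariant of a diagonal form -/

/-- **The Stiefel–Whitney invariant of the diagonal form `⟨a₁, …, a_r⟩` (the module `(a₁) ⊕ ⋯ ⊕ (a_r)`):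
`w = (1 + l(a₁))(1 + l(a₂))⋯(1 + l(a_r))`**, here in the ring `k_*F`. [cite: Milnor1970, §3 «w(M) = (1 + l(a₁))(1 + l(a₂))⋯(1 + l(a_r))» (p0011 L1–L6)] -/
def sw (d : List Fˣ) : Mod2Ring F := (d.map fun a => 1 + kl F a).prod

/-- `w` of the zero module is `1`. [cite: Milnor1970, §3 «w(M) = (1 + l(a₁))(1 + l(a₂))⋯(1 + l(a_r))» (p0011 L1–L6)] -/
theorem sw_nil : sw F [] = 1 := rfl

/-- `w((a) ⊕ M) = (1 + l(a)) w(M)`. [cite: Milnor1970, §3 «w(M) = (1 + l(a₁))(1 + l(a₂))⋯(1 + l(a_r))» (p0011 L1–L6)] -/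
theorem sw_cons (a : Fˣ) (d : List Fˣ) : sw F (a :: d) = (1 + kl F a) * sw F d := by
  rw [sw, List.map_cons, List.prod_cons]; rfl

/-- **The Whitney sum formula `w(M ⊕ N) = w(M) w(N)`** for diagonalizations. [cite: Milnor1970, §3 Lemma 3.1 (p0011 L24–L29)] -/
theorem sw_append (d d' : List Fˣ) : sw F (d ++ d') = sw F d * sw F d' := by
  rw [sw, List.map_append, List.prod_append]; rfl

/-- `w((a)) = 1 + l(a)`. [cite: Milnor1970, §3 «w(M) = (1 + l(a₁))(1 + l(a₂))⋯(1 + l(a_r))» (p0011 L1–L6)] -/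
theorem sw_singleton (a : Fˣ) : sw F [a] = 1 + kl F a := by rw [sw_cons, sw_nil, mul_one]

/-- `w((a) ⊕ (b)) = (1 + l(a))(1 + l(b))`. [cite: Milnor1970, §3 «w(M) = (1 + l(a₁))(1 + l(a₂))⋯(1 + l(a_r))» (p0011 L1–L6)] -/
theorem sw_pair (a b : Fˣ) : sw F [a, b] = (1 + kl F a) * (1 + kl F b) := by rw [sw_cons, sw_singleton]

/-- **`w((a) ⊕ (b)) = 1 + w₁ + w₂`** with `w₁ = l(a) + l(b) ∈ k₁F`, `w₂ = l(a)l(b) ∈ k₂F` («Thus w(M) can be written as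
1 + w₁(M) + ⋯ + w_r(M)»). [cite: Milnor1970, §3 (p0011 L6–L10)] -/
theorem sw_pair_eq (a b : Fˣ) :
    sw F [a, b] = 1 + kOfDeg F 1 (MilnorK.swOne a b) + kOfDeg F 2 (MilnorK.swTwo a b) := by
  rw [sw_pair, kOfDeg_swOne, kOfDeg_swTwo, mul_add, add_mul, one_mul, mul_one, add_mul, one_mul]
  abel

/-- **LEMMA 3.1, the rank-`2` case: `(a) ⊕ (b) ≅ (α) ⊕ (β) ⇒ w((a) ⊕ (b)) = w((α) ⊕ (β))`** (characteristic `≠ 2`; from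
`sw_eq_of_isometryEquiv` of `MilnorKStiefelWhitneyBinary`). [cite: Milnor1970, §3 Lemma 3.1 «it suffices to consider the rank 2 case» (p0011 L26–L29)] -/
theorem sw_pair_eq_of_equivalent (h2 : (2 : F) ≠ 0) {a b α β : Fˣ}
    (h : (MilnorK.binaryForm (a : F) b).Equivalent (MilnorK.binaryForm (α : F) β)) : sw F [a, b] = sw F [α, β] := by
  obtain ⟨e⟩ := h
  obtain ⟨h1, h2'⟩ := MilnorK.sw_eq_of_isometryEquiv h2 a b α β e
  rw [sw_pair_eq, sw_pair_eq, h1, h2']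

/-! ### chain equivalence of diagonalizations -/

/-- One step of a chain of diagonalizations: two adjacent entries `a, b` are replaced by `α, β` with
`(a) ⊕ (b) ≅ (α) ⊕ (β)` («it suffices to consider the rank 2 case»). [cite: Milnor1970, §3 Lemma 3.1 «it suffices to consider the rank 2 case» (p0011 L26–L29)] -/
inductive ChainStep : List Fˣ → List Fˣ → Prop
  | pair (d₁ d₂ : List Fˣ) {a b α β : Fˣ}
      (h : (MilnorK.binaryForm (a : F) b).Equivalent (MilnorK.binaryForm (α : F) β)) :
      ChainStep (d₁ ++ a :: b :: d₂) (d₁ ++ α :: β :: d₂)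

/-- **Chain equivalence of diagonalizations**: the equivalence relation generated by the steps `ChainStep` (Witt's chain
equivalence; by Witt's theorem — «the classical proof that the Hasse-Witt invariant is well defined», not formalised here —
isometric diagonal forms are chain equivalent). [cite: Milnor1970, §3 Lemma 3.1 «it suffices to consider the rank 2 case» (p0011 L26–L29)] -/
def ChainEquiv : List Fˣ → List Fˣ → Prop := Relation.EqvGen (ChainStep F)

/-- A chain step does not change `w` (Whitney sum formula and the rank-`2` case). [cite: Milnor1970, §3 Lemma 3.1 «it suffices to consider the rank 2 case» (p0011 L26–L29)] -/
theorem sw_eq_of_chainStep (h2 : (2 : F) ≠ 0) {d d' : List Fˣ} (h : ChainStep F d d') : sw F d = sw F d' := by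
  cases h with
  | pair d₁ d₂ h =>
    rw [sw_append, sw_append, sw_cons, sw_cons, sw_cons, sw_cons, ← _root_.mul_assoc (1 + kl F _),
      ← _root_.mul_assoc (1 + kl F _), ← sw_pair, ← sw_pair, sw_pair_eq_of_equivalent F h2 h]

/-- **LEMMA 3.1 modulo Witt's chain-equivalence theorem: chain-equivalent diagonalizations have the same Stiefel–Whitney
invariant** (characteristic `≠ 2`). [cite: Milnor1970, §3 Lemma 3.1 (p0011 L24–L29)] -/
theorem sw_eq_of_chainEquiv (h2 : (2 : F) ≠ 0) {d d' : List Fˣ} (h : ChainEquiv F d d') : sw F d = sw F d' := by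
  induction h with
  | rel x y hxy => exact sw_eq_of_chainStep F h2 hxy
  | refl x => rfl
  | symm x y _ ih => exact ih.symm
  | trans x y z _ _ ih₁ ih₂ => exact ih₁.trans ih₂

/-- The coordinate swap is an isometry `(a) ⊕ (b) ≅ (b) ⊕ (a)`. [folklore] -/
def binaryFormSwap (a b : F) : (MilnorK.binaryForm a b).IsometryEquiv (MilnorK.binaryForm b a) :=
  { LinearEquiv.funCongrLeft F F (Equiv.swap (0 : Fin 2) 1) with
    map_app' := fun v => by
      change MilnorK.binaryForm b a (LinearEquiv.funCongrLeft F F (Equiv.swap (0 : Fin 2) 1) v) = MilnorK.binaryForm a b v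
      rw [MilnorK.binaryForm_apply, MilnorK.binaryForm_apply, LinearEquiv.funCongrLeft_apply, LinearMap.funLeft_apply,
        LinearMap.funLeft_apply, Equiv.swap_apply_left, Equiv.swap_apply_right, add_comm] }

/-- `(a) ⊕ (b)` and `(b) ⊕ (a)` are equivalent quadratic modules. [cite: Milnor1970, §3 «orthogonal direct sum (a₁) ⊕ ⋯ ⊕ (a_r)»
(p0010 L35 – p0011 L1)] -/
theorem binaryForm_equivalent_swap (a b : F) : (MilnorK.binaryForm a b).Equivalent (MilnorK.binaryForm b a) :=
  ⟨binaryFormSwap F a b⟩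

/-- Adjacent transpositions of a diagonalization are chain steps. [cite: Milnor1970, §3 Lemma 3.1 «it suffices to consider the rank 2 case» (p0011 L26–L29)] -/
theorem chainStep_swap (d₁ d₂ : List Fˣ) (a b : Fˣ) : ChainStep F (d₁ ++ a :: b :: d₂) (d₁ ++ b :: a :: d₂) :=
  ChainStep.pair d₁ d₂ (binaryForm_equivalent_swap F a b)

/-- `w` is invariant under adjacent transpositions (any characteristic: `k_*F` is commutative). [cite: Milnor1970, §3 «w(M) = (1 + l(a₁))(1 + l(a₂))⋯(1 + l(a_r))» (p0011 L1–L6)] -/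
theorem sw_swap (d₁ d₂ : List Fˣ) (a b : Fˣ) : sw F (d₁ ++ a :: b :: d₂) = sw F (d₁ ++ b :: a :: d₂) := by
  rw [sw_append, sw_append, sw_cons, sw_cons, sw_cons, sw_cons, ← _root_.mul_assoc (1 + kl F a),
    ← _root_.mul_assoc (1 + kl F b), mul_comm' F (1 + kl F a)]

end MilnorKStar

end Field

end Literature.RingTheory.KTheory

end
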